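import Mathlib
import Summits.CriticalPhenomena.Ising3DConformalLimit.Theses.PrecisionLaplacian
import Summits.CriticalPhenomena.Ising3DConformalLimit.Theorems.PrecisionLaplacianTwoPointSpineGlueKernel
import Summits.CriticalPhenomena.Ising3DConformalLimit.Theorems.PrecisionLaplacianTwoPointSpineGlueEtaBounds
import Summits.CriticalPhenomena.Ising3DConformalLimit.Theorems.PrecisionLaplacianTwoPointSpineGlueLipschitz
import Summits.CriticalPhenomena.Ising3DConformalLimit.Theorems.PrecisionLaplacianTwoPointSpineGlueBlockLimit
import Summits.CriticalPhenomena.Ising3DConformalLimit.Theorems.PrecisionLaplacianTwoPointSpineGlueLimitKernel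
import Summits.CriticalPhenomena.Ising3DConformalLimit.Theorems.HyperoctahedralRPHRP2Rigidity
import Literature.Probability.LatticeModels.HighDimPointwiseTriviality
import HarnessLib

/-!
# `PrecisionLaplacian.TwoPointSpineGlue` (stmt-CriticalPhenomena-4805) — PROVED, unconditionally

**Theorem (`twoPointSpineGlue_proof`).**  The support hypothesis `TwoPointSpineGlue` of route
`PrecisionLaplacian`: under (i) the symmetric-potential / M-matrix hypothesis for the finite covariance
matrices of `G = ⟨σ₀σ_x⟩_{β_c}` on `ℤ³`, (ii) TAIL — the direct-correlation function `a(x)` has a continuous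
non-negative, somewhere positive angular profile `Φ` at order `|x|^{-(5-η)}`, `0 < η < 1` —, (iii) the crux
`StableConeRPRigidity` and (iv) the nine-mirror lattice reflection positivity of the critical correlators,
there are `Δ` and `c > 0` with `⟨σ₀σ_x⟩_{β_c}|x|₂^{2Δ} → c` (`2Δ = 1 + η`): the critical two-point function
is an isotropic pure power at large distance.

The proof does NOT use hypothesis (iii) and NO unproved named fact; it is the "monotone–Tauberian" line of
the helper files `…TwoPointSpineGlue{Green, Kernel, Symbol, HeavyBoxes, EtaBounds, LogConvex, AxisDecrement,
Lipschitz, Parseval, StepIntegral, SymbolLimit, Dirichlet, BlockLimit, Rays, Tauberian, LimitKernel}`: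

1. TAIL in vector form ⇒ heavy boxes `a ≥ c L^{-(5-η)}` on `ctr L + box L` and an envelope `a ≤ C‖x‖^{-(5-η)}`
   (`heavyBoxes_of_profile`, `upper_of_profile`); with (i) the Green package `A₀ G = δ₀ + b ∗ G`, `b = a ≥ 0`
   off `0`, `G = A₀⁻¹ Σₙ Pₙ` (`green_package_full_of_pos`) and the two-sided bounds
   `c'‖x‖^{-(1+η)} ≤ G ≤ C'‖x‖^{-(1+η)}` (`hasIsingEtaBounds_of_heavyBoxes`).
2. (iv) ⇒ coordinate-mirror RP of `G` ⇒ (with Messager–Miracle-Solé and the envelope) `G` is Lipschitz at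
   scale: `|G(z') − G(z)| ≤ C‖z' − z‖₁‖z‖^{-(2+η)}` (`lipschitz_at_scale`).
3. The symbol bound `1 − q̂(k) ≥ c₁|k|^{2-η}` from the heavy boxes (`psi_lower_of_boxes`) and TAIL for the step
   law `q = b/A₀` give block scaling limits of `Σₙ Pₙ` around every ray (`block_scaling_limit`, lattice Fourier
   analysis), hence of `G`.
4. Tauberian step (`exists_limit_kernel`): 2 + 3 + the lower bound ⇒ a kernel `U`, continuous and positive off
   `0`, homogeneous of degree `-(1+η)`, with `G(x)‖x‖₂^{1+η} − U(x/‖x‖₂) → 0`.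
5. (iv) passes to `U` for the nine lattice mirrors (`nineMirror_of_latticeRP`), and nine-mirror RP rigidity
   below degree four (`HRP2Rigidity.XRayMellin.nineMirrorRigidityBelowFour`, the closed sibling crux) makes `U`
   `O(3)`-invariant, i.e. constant on the unit sphere: `G(x)‖x‖₂^{1+η} → U(e₀) > 0`.
-/

noncomputable section

namespace Summit.CriticalPhenomena.Ising3DConformalLimit.Theorems.SpineGlue

open Filter Topology Finset
open Literature.Probability.LatticeModels
open scoped InnerProductSpace

/-! ### From the route's TAIL profile on `Fin 3 → ℝ` to kernels on `ℝ³` -/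

/-- A point of the unit sphere of `ℝ³` has `∑ vᵢ² = 1`. -/
theorem sum_sq_eq_one_of_mem_sphere {v : EuclideanSpace ℝ (Fin 3)}
    (hv : v ∈ Metric.sphere (0 : EuclideanSpace ℝ (Fin 3)) 1) : ∑ i, (v i) ^ 2 = 1 := by
  rw [mem_sphere_zero_iff_norm, EuclideanSpace.norm_eq, Real.sqrt_eq_one] at hv
  simpa [Real.norm_eq_abs, sq_abs] using hv

/-- A coordinate vector with `∑ uᵢ² = 1` is a point of the unit sphere of `ℝ³`. -/
theorem toLp_mem_sphere {u : Fin 3 → ℝ} (hu : ∑ i, u i ^ 2 = 1) :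
    (WithLp.toLp 2 u : EuclideanSpace ℝ (Fin 3)) ∈ Metric.sphere (0 : EuclideanSpace ℝ (Fin 3)) 1 := by
  rw [mem_sphere_zero_iff_norm, EuclideanSpace.norm_eq]
  have : ∑ i, ‖(WithLp.toLp 2 u : EuclideanSpace ℝ (Fin 3)) i‖ ^ 2 = 1 := by
    simpa [Real.norm_eq_abs, sq_abs] using hu
  rw [this, Real.sqrt_one]

/-- A profile continuous on `{∑ uᵢ² = 1}` gives a kernel `v ↦ Φ v` continuous on the unit sphere. -/
theorem continuousOn_profile {Φ : (Fin 3 → ℝ) → ℝ} (hΦc : ContinuousOn Φ {u | ∑ i, u i ^ 2 = 1}) :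
    ContinuousOn (fun v : EuclideanSpace ℝ (Fin 3) => Φ (⇑v)) (Metric.sphere 0 1) :=
  hΦc.comp (PiLp.continuous_ofLp 2 _).continuousOn fun _ hv => sum_sq_eq_one_of_mem_sphere hv

/-- The route's direction `(xᵢ / |x|₂)ᵢ` is the coordinate vector of `|x|₂⁻¹ • x`. -/
theorem dir_eq (x : Site 3) :
    (fun i => (x i : ℝ) / Real.sqrt (∑ j, ((x j : ℝ)) ^ 2)) = ⇑(‖siteVec x‖⁻¹ • siteVec x) := by
  funext i
  rw [← norm_siteVec, PiLp.smul_apply, siteVec_apply, smul_eq_mul, div_eq_inv_mul]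

/-- The route's TAIL statement in vector form: `F x ‖x‖₂^r - Φ(x̂) → 0`. -/
theorem tendsto_vec_form {F : Site 3 → ℝ} {r : ℝ} {Φ : (Fin 3 → ℝ) → ℝ}
    (hF : Tendsto (fun x : Site 3 => F x * Real.sqrt (∑ j, ((x j : ℝ)) ^ 2) ^ r -
      Φ (fun i => (x i : ℝ) / Real.sqrt (∑ j, ((x j : ℝ)) ^ 2))) cofinite (𝓝 0)) :
    Tendsto (fun x : Site 3 => F x * ‖siteVec x‖ ^ r -
      (fun v : EuclideanSpace ℝ (Fin 3) => Φ (⇑v)) (‖siteVec x‖⁻¹ • siteVec x)) cofinite (𝓝 0) := by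
  refine hF.congr fun x => ?_
  rw [dir_eq x, norm_siteVec]

/-- The coordinate unit vectors lie in every box of side `≥ 1`. -/
theorem single_mem_box {L : ℕ} (hL : 1 ≤ L) (i : Fin 3) : (Pi.single i (1 : ℤ) : Site 3) ∈ box 3 L := by
  rw [mem_box]
  intro j
  by_cases h : j = i
  · subst h; simp only [Pi.single_eq_same]; constructor <;> omega
  · simp only [Pi.single_eq_of_ne h]; constructor <;> omega

/-- The coordinates of the rescaled lattice approximations of `w` converge to those of `w`. -/
theorem tendsto_coord_latticeApprox (w : EuclideanSpace ℝ (Fin 3)) (j : Fin 3) :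
    Tendsto (fun N : ℕ => ((latticeApprox ((N : ℝ)⁻¹) w j : ℤ) : ℝ) / N) atTop (𝓝 (w j)) := by
  have h1 := ((PiLp.continuous_ofLp 2 (fun _ : Fin 3 => ℝ)).tendsto w).comp (tendsto_inv_smul_latticeApprox w)
  have h2 := tendsto_pi_nhds.1 h1 j
  refine h2.congr fun N => ?_
  simp only [Function.comp_apply, WithLp.ofLp_smul, Pi.smul_apply, smul_eq_mul, siteVec_apply, div_eq_inv_mul]

/-! ### The theorem -/

/-- **`TwoPointSpineGlue` (route `PrecisionLaplacian`, item stmt-CriticalPhenomena-4805), proved.**  Under the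
symmetric-potential hypothesis for `G = criticalTwoPoint 3`, TAIL, `StableConeRPRigidity` (not used) and the
nine-mirror lattice reflection positivity of the critical correlators, there are `Δ` and `c > 0` with
`⟨σ₀σ_x⟩_{β_c} · |x|₂^{2Δ} → c` cofinitely (`2Δ = 1 + η`).  See the module docstring for the chain. -/
theorem twoPointSpineGlue_proof :
    Summit.CriticalPhenomena.Ising3DConformalLimit.Theses.PrecisionLaplacian.TwoPointSpineGlue := by
  intro hSP hTail _ hNine
  obtain ⟨η, Φ, hη0, hη1, hΦc, hΦnn, hΦpos, hT⟩ := hTail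
  -- Step 0: notation — the direct-correlation function `a`, the profile `Φv` on `ℝ³`, exponents
  set a : Site 3 → ℝ := fun y => ⨅ A : {A : Finset (Site 3) // (0 : Site 3) ∈ A ∧ y ∈ A},
    -((Matrix.of fun (p q : ↥A.1) => criticalTwoPoint 3 (q.1 - p.1))⁻¹ ⟨0, A.2.1⟩ ⟨y, A.2.2⟩) with hadef
  set Φv : EuclideanSpace ℝ (Fin 3) → ℝ := fun v => Φ (⇑v) with hΦv
  have hΦvc : ContinuousOn Φv (Metric.sphere 0 1) := continuousOn_profile hΦc
  have hTv : Tendsto (fun x : Site 3 => a x * ‖siteVec x‖ ^ (5 - η) - Φv (‖siteVec x‖⁻¹ • siteVec x))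
      cofinite (𝓝 0) := tendsto_vec_form hT
  obtain ⟨u₀, hu₀, hΦu₀⟩ := hΦpos
  set w₀ : EuclideanSpace ℝ (Fin 3) := WithLp.toLp 2 u₀ with hw₀
  have hw₀n : ‖w₀‖ = 1 := mem_sphere_zero_iff_norm.1 (toLp_mem_sphere hu₀)
  have hΦw₀ : 0 < Φv w₀ := by simp only [hΦv, hw₀]; exact hΦu₀
  set s : ℝ := 1 + η with hs
  set α : ℝ := 2 - η with hα
  have hs0 : 0 < s := by rw [hs]; linarith
  have hs4 : s < 4 := by rw [hs]; linarith
  have hα0 : 0 < α := by rw [hα]; linarith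
  have hα2 : α < 2 := by rw [hα]; linarith
  have hr : (0 : ℝ) ≤ 5 - η := by linarith
  -- Step 1: heavy boxes, envelope, two-sided `η`-bounds, positivity of `G`
  obtain ⟨c, L₀, ctr, hc, hL₀, hheavy⟩ := heavyBoxes_of_profile (a := a) hr hΦvc hw₀n hΦw₀ hTv
  obtain ⟨Cu, _, hup⟩ := upper_of_profile (a := a) hr hΦvc hTv
  have hEta : HasIsingEtaBounds 3 η := hasIsingEtaBounds_of_heavyBoxes hSP hη0 hη1 hc hL₀ ctr hheavy hup
  obtain ⟨c', C', hc', hbounds⟩ := hEta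
  have hpow : ∀ x : Site 3, x ≠ 0 →
      c' * ‖x‖ ^ (-s) ≤ criticalTwoPoint 3 x ∧ criticalTwoPoint 3 x ≤ C' * ‖x‖ ^ (-s) := by
    intro x hx
    have h := hbounds x hx
    have e : ((3 : ℕ) : ℝ) - 2 + η = s := by rw [hs]; norm_num
    rwa [e] at h
  have hGpos : ∀ x : Site 3, 0 < criticalTwoPoint 3 x := by
    intro x
    by_cases hx : x = 0
    · rw [hx, criticalTwoPoint_zero']; exact one_pos
    · exact lt_of_lt_of_le (mul_pos hc' (Real.rpow_pos_of_pos (norm_pos_iff.2 hx) _)) (hpow x hx).1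
  -- Step 2: the positive site `y₀ = ctr L₀` and the Green package
  obtain ⟨hy₀0, hy₀⟩ := hheavy L₀ le_rfl 0 (zero_mem_box 3 L₀)
  rw [add_zero] at hy₀0 hy₀
  have hL₀pos : (0 : ℝ) < L₀ := by exact_mod_cast hL₀
  have hay₀ : 0 < a (ctr L₀) := lt_of_lt_of_le (mul_pos hc (Real.rpow_pos_of_pos hL₀pos _)) hy₀
  obtain ⟨A₀, b, P, hA0, hb0, hbs, hbev, hbA, hba, _, hP0, hPs, hPnn, hPsum, hPn, hGP, _, _⟩ :=
    green_package_full_of_pos hSP hy₀0 hay₀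
  have hba' : ∀ y, y ≠ 0 → b y = a y := hba
  have hC'pos : 0 < C' :=
    pos_of_mul_pos_left (lt_of_lt_of_le (hGpos _) (hpow _ hy₀0).2) (Real.rpow_nonneg (norm_nonneg _) _)
  -- Step 3: the step law `q = b / A₀`, its heavy boxes, symbol bound and tail
  set q : Site 3 → ℝ := fun y => b y / A₀ with hq
  have hq0 : ∀ y, 0 ≤ q y := fun y => div_nonneg (hb0 y) hA0.le
  have hqs : Summable q := hbs.div_const A₀
  have hq1 : ∑' y, q y = 1 := by
    show ∑' y, b y / A₀ = 1
    rw [tsum_div_const, hbA, div_self hA0.ne']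
  have hqev : ∀ y, q (-y) = q y := fun y => by simp only [hq, hbev]
  have hqpos : ∀ L : ℕ, L₀ ≤ L → ∀ u ∈ box 3 L, 0 < q (ctr L + u) := by
    intro L hL u hu
    obtain ⟨hne, hle⟩ := hheavy L hL u hu
    have hLpos : (0 : ℝ) < L := by
      have : (1 : ℝ) ≤ L := by exact_mod_cast hL₀.trans hL
      linarith
    have hapos : 0 < a (ctr L + u) := lt_of_lt_of_le (mul_pos hc (Real.rpow_pos_of_pos hLpos _)) hle
    simp only [hq, hba' _ hne]
    exact div_pos hapos hA0
  have hy₁ : 0 < q (ctr L₀) := by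
    have h := hqpos L₀ le_rfl 0 (zero_mem_box 3 L₀)
    rwa [add_zero] at h
  have hy₁' : ∀ i : Fin 3, 0 < q (ctr L₀ + Pi.single i 1) := fun i =>
    hqpos L₀ le_rfl _ (single_mem_box hL₀ i)
  have hPs' : ∀ n z, P (n + 1) z = ∑' y, q y * P n (z - y) := hPs
  obtain ⟨c₁, hc₁0, hψ⟩ := psi_lower_of_boxes (d := 3) (by norm_num) (α := α) hc hα0 hb0 hbs hL₀ ctr
    (fun L hL u hu => by
      obtain ⟨hne, hle⟩ := hheavy L hL u hu
      rw [hba' _ hne]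
      convert hle using 3
      rw [hα]; push_cast; ring)
  have hlow_symbol : ∀ k : Fin 3 → ℝ, ‖k‖ ≤ Real.pi → k ≠ 0 →
      c₁ / A₀ * ‖k‖ ^ α ≤ 1 - ∑' y, q y * Real.cos (phase 3 k y) := by
    intro k hk hk0
    have hsc : Summable fun y => q y * Real.cos (phase 3 k y) :=
      Summable.of_norm_bounded hqs fun y => by
        rw [Real.norm_eq_abs, abs_mul, abs_of_nonneg (hq0 y)]
        exact mul_le_of_le_one_right (hq0 y) (Real.abs_cos_le_one _)
    have h1 : 1 - ∑' y, q y * Real.cos (phase 3 k y) = A₀⁻¹ * ∑' y, b y * (1 - Real.cos (phase 3 k y)) := by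
      calc 1 - ∑' y, q y * Real.cos (phase 3 k y)
          = ∑' y, q y - ∑' y, q y * Real.cos (phase 3 k y) := by rw [hq1]
        _ = ∑' y, (q y - q y * Real.cos (phase 3 k y)) := (Summable.tsum_sub hqs hsc).symm
        _ = A₀⁻¹ * ∑' y, b y * (1 - Real.cos (phase 3 k y)) := by
            rw [← tsum_mul_left]
            refine tsum_congr fun y => ?_
            simp only [hq, div_eq_mul_inv]
            ring
    rw [h1]
    calc c₁ / A₀ * ‖k‖ ^ α = A₀⁻¹ * (c₁ * ‖k‖ ^ α) := by rw [div_eq_mul_inv]; ring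
      _ ≤ A₀⁻¹ * ∑' y, b y * (1 - Real.cos (phase 3 k y)) :=
          mul_le_mul_of_nonneg_left (hψ k hk hk0) (inv_nonneg.2 hA0.le)
  set Ψ : EuclideanSpace ℝ (Fin 3) → ℝ := fun v => Φ (⇑v) / A₀ with hΨ
  have hΨc : ContinuousOn Ψ (Metric.sphere 0 1) := (continuousOn_profile hΦc).div_const _
  have hTq : Tendsto (fun x : Site 3 => q x * ‖siteVec x‖ ^ (3 + α) - Ψ (‖siteVec x‖⁻¹ • siteVec x))
      cofinite (𝓝 0) := by
    have h := hTv.div_const A₀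
    rw [zero_div] at h
    refine h.congr' ?_
    filter_upwards [eventually_cofinite_ne (0 : Site 3)] with x hx
    simp only [hq, hΨ, hΦv, hba' x hx, show (3 : ℝ) + α = 5 - η by rw [hα]; ring]
    ring
  -- Step 4: `G` is Lipschitz at scale (RP for the coordinate mirrors, MMS, envelope)
  have hLipG : ∀ z z' : Site 3, 16 ≤ ‖z‖ → (∑ l, |((z' l - z l : ℤ) : ℝ)|) ≤ ‖z‖ / 2 →
      |criticalTwoPoint 3 z' - criticalTwoPoint 3 z| ≤
        C' * 8 ^ (s + 1) * 4 ^ (s + 1) * (∑ l, |((z' l - z l : ℤ) : ℝ)|) * ‖z‖ ^ (-(s + 1)) :=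
    fun z z' hz hd => lipschitz_at_scale (latticeRP_coord_of_corr hNine) hGpos hs0
      (fun y hy => (hpow y hy).2) z z' hz hd
  have hC0 : 0 ≤ C' * 8 ^ (s + 1) * 4 ^ (s + 1) :=
    mul_nonneg (mul_nonneg hC'pos.le (by positivity)) (by positivity)
  -- Step 5: block scaling limits of `G` around every ray
  have hΛG : ∀ w : EuclideanSpace ℝ (Fin 3), w ≠ 0 → ∀ δ : ℝ, 0 < δ → ∃ Λ : ℝ,
      Tendsto (fun N : ℕ => (N : ℝ) ^ (s - 6) *
        ∑ u ∈ box 3 ⌊δ * N⌋₊, ∑ u' ∈ box 3 ⌊δ * N⌋₊,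
          criticalTwoPoint 3 (latticeApprox ((N : ℝ)⁻¹) w + u - u')) atTop (𝓝 Λ) := by
    intro w _ δ hδ
    obtain ⟨Λ, hΛ⟩ := block_scaling_limit hα0 hα2 hq0 hqs hq1 hqev (ctr L₀) hy₁ hy₁' hP0 hPs' hPnn hPsum hPn
      (div_pos hc₁0 hA0) hlow_symbol hΨc hTq (⇑w) (fun N : ℕ => latticeApprox ((N : ℝ)⁻¹) w)
      (tendsto_coord_latticeApprox w) hδ
    refine ⟨A₀⁻¹ * Λ, (hΛ.const_mul A₀⁻¹).congr fun N => ?_⟩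
    simp only [hGP, ← Finset.mul_sum]
    rw [show s - 6 = -(3 + α) by rw [hs, hα]; ring]
    ring
  -- Step 6: the limit kernel `U`
  obtain ⟨U, hUc, hUpos, hUhom, hGU⟩ :=
    exists_limit_kernel hs0 hC0 hLipG hΛG hc' (fun z hz => (hpow z hz).1)
  -- Step 7: the nine lattice mirrors pass to `U`; RP rigidity below degree four makes `U` isotropic
  have hRP2 := latticeRP_two_of_corr hNine
  have hUiso : ∀ (R : EuclideanSpace ℝ (Fin 3) ≃ₗᵢ[ℝ] EuclideanSpace ℝ (Fin 3)) (x : EuclideanSpace ℝ (Fin 3)),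
      U (R x) = U x :=
    _root_.Summit.CriticalPhenomena.Ising3DConformalLimit.Cruxes.HRP2Rigidity.XRayMellin.nineMirrorRigidityBelowFour
      s U hs0 hs4 hUc hUpos hUhom (fun n hn => nineMirror_of_latticeRP hUc hUhom hGU hRP2 hn)
  -- Step 8: the isotropic pure power law
  set e : EuclideanSpace ℝ (Fin 3) := EuclideanSpace.single 0 1 with he
  have hen : ‖e‖ = 1 := norm_single_one 0
  have he0 : e ≠ 0 := by
    intro h; rw [h, norm_zero] at hen; exact zero_ne_one hen
  refine ⟨s / 2, U e, hUpos e he0, ?_⟩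
  have h1 := hGU.add_const (U e)
  rw [zero_add] at h1
  refine h1.congr' ?_
  filter_upwards [eventually_cofinite_ne (0 : Site 3)] with x hx
  have hxn : 0 < ‖siteVec x‖ := norm_pos_iff.2 (fun h => hx ((siteVec_eq_zero_iff x).1 h))
  have hunit : ‖‖siteVec x‖⁻¹ • siteVec x‖ = 1 := by
    rw [norm_smul, norm_inv, norm_norm, inv_mul_cancel₀ hxn.ne']
  have hUx : U (‖siteVec x‖⁻¹ • siteVec x) = U e := const_on_sphere_of_isometry_invariant hUiso hunit hen
  rw [hUx, ← norm_siteVec, show 2 * (s / 2) = s by ring]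
  ring

end Summit.CriticalPhenomena.Ising3DConformalLimit.Theorems.SpineGlue

end
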